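import Literature.MathematicalPhysics.QuantumLattice.BootstrapCertificateDuality
import HarnessLib

/-!
# REVIEW-RUNBOOK sanity lemmas — the many-body bootstrap's two bound formats are INHABITED
# (client `pub-mbboot` of the ops review-runbook generator)

Card (2)(b) («non-vacuity») of `run/shared/lean/pub/pub-mbboot/REVIEW-RUNBOOK.md`.  The two headline
bound formats of `Literature/MathematicalPhysics/QuantumLattice/BootstrapCertificateDuality.lean` are
implications whose hypotheses describe a TRIAL STATE (`groundEnergy_le_of_trial`: an `N`-particle Fock
vector of norm one) resp. a DUAL CERTIFICATE (`le_groundEnergy_of_certificate`: a Gram matrix `G ≽ 0`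
and a positive-semidefinite residual on the `N`-particle block).  This file records, as closed theorems
`∃ objects, h₁ ∧ … ∧ hₙ` (the shape the generator's probe matches; both statements are universe-
polymorphic in the site type, which runbook-probe/13 instantiates), that each format is inhabited on the
ONE-SITE lattice `ι = Fin 1`:

* trial state: `N = 1`, `ψ = |{0}⟩` (the single site occupied) — supported on the one subset of
  cardinality `1`, of norm `1`;
* certificate: `H = 0`, `N = 1 ≤ |Fin 1|`, one dual index `κ = Fin 1` with `O = 0`, Gram matrix
  `G = 0 ≽ 0`, and `(c, ε) = (−1, 0)`: the residual `0|_{N=1} + 1 − 0 + 0 = 1 ≽ 0`, certifying the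
  (true, weak) bound `E₀(0) ≥ −1` — a FORMAT check (the scheme is consistent and its side conditions
  are jointly met), not a physics statement.

Review evidence only; nothing here is used by a theorem of the tree; no definitions, no `sorry`,
standard axioms.
-/

noncomputable section

namespace Summit.HubbardSuperconductivity.ManyBodyBootstrap.Runbook

open Matrix Literature.MathematicalPhysics.QuantumLattice
open scoped ComplexOrder

/-- The one-particle state `|{0}⟩` on the one-site lattice: a Fock vector on `Fin 1` supported on the
subset `{0}`. [folklore] -/
theorem isNParticle_single_fin1 :
    IsNParticle 1 (Pi.single ({0} : Finset (Fin 1)) (1 : ℂ) : Fock (Fin 1)) := by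
  intro s hs
  have hne : s ≠ {0} := fun h => hs (by rw [h, Finset.card_singleton])
  exact Pi.single_eq_of_ne hne _

/-- `⟨{0}|{0}⟩ = 1` on the one-site lattice. [folklore] -/
theorem norm_single_fin1 :
    star (Pi.single ({0} : Finset (Fin 1)) (1 : ℂ) : Fock (Fin 1)) ⬝ᵥ
      (Pi.single ({0} : Finset (Fin 1)) (1 : ℂ) : Fock (Fin 1)) = 1 := by
  rw [dotProduct, Finset.sum_eq_single ({0} : Finset (Fin 1))]
  · simp
  · intro b _ hb
    simp [Pi.single_eq_of_ne hb]
  · intro h; exact absurd (Finset.mem_univ _) h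

/-- (b) **The two hypotheses of `groundEnergy_le_of_trial` hold together** on the one-site lattice:
`N = 1`, `ψ = |{0}⟩` is a `1`-particle vector (`isNParticle_single_fin1`) of norm one
(`norm_single_fin1`) — the trial-state class is inhabited. [folklore] -/
theorem groundEnergy_le_of_trial_hypotheses :
    ∃ (N : ℕ) (ψ : Fock (Fin 1)), IsNParticle N ψ ∧ star ψ ⬝ᵥ ψ = 1 :=
  ⟨1, _, isNParticle_single_fin1, norm_single_fin1⟩

/-- (b) **The three hypotheses of `le_groundEnergy_of_certificate` hold together** (format check on the
one-site lattice): `H = 0`, `N = 1 ≤ |Fin 1|`, `κ = Fin 1`, `O = 0`, `G = 0` (positive semidefinite),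
`c = −1`, `ε = 0`: the residual matrix is the identity on the `1`-particle block, positive semidefinite.
[folklore] -/
theorem le_groundEnergy_of_certificate_hypotheses :
    ∃ (H : Matrix (Finset (Fin 1)) (Finset (Fin 1)) ℂ) (N : ℕ)
      (O : Fin 1 → Matrix {s : Finset (Fin 1) // s.card = N} {s : Finset (Fin 1) // s.card = N} ℂ)
      (G : Matrix (Fin 1) (Fin 1) ℂ) (c ε : ℝ),
      N ≤ Fintype.card (Fin 1) ∧ G.PosSemidef ∧
        (H.toBlock (fun s : Finset (Fin 1) => s.card = N) (fun s : Finset (Fin 1) => s.card = N)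
            - (c : ℂ) • 1 - ∑ a, ∑ b, G a b • ((O a)ᴴ * O b) + (ε : ℂ) • 1).PosSemidef := by
  refine ⟨0, 1, 0, 0, -1, 0, by simp, PosSemidef.zero, ?_⟩
  have h : ((0 : Matrix (Finset (Fin 1)) (Finset (Fin 1)) ℂ).toBlock (fun s : Finset (Fin 1) => s.card = 1)
        (fun s : Finset (Fin 1) => s.card = 1) - ((-1 : ℝ) : ℂ) • 1
        - ∑ a : Fin 1, ∑ b : Fin 1, (0 : Matrix (Fin 1) (Fin 1) ℂ) a b •
            (((0 : Fin 1 → Matrix {s : Finset (Fin 1) // s.card = 1} {s : Finset (Fin 1) // s.card = 1} ℂ) a)ᴴ *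
              (0 : Fin 1 → Matrix {s : Finset (Fin 1) // s.card = 1} {s : Finset (Fin 1) // s.card = 1} ℂ) b)
        + ((0 : ℝ) : ℂ) • 1) = 1 := by
    ext i j
    simp [Matrix.toBlock_apply, Matrix.one_apply]
  rw [h]
  exact PosSemidef.one

end Summit.HubbardSuperconductivity.ManyBodyBootstrap.Runbook

end
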